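import Summits.HubbardSuperconductivity.HubbardSuperconductivity.Theorems.CooperPairDMottWalkCooperPairDMottPlaquetteGCWindowTransport
import Summits.HubbardSuperconductivity.HubbardSuperconductivity.Theorems.CooperPairDMottWalkCooperPairDMottPlaquettePairBinding

/-!
# Route `CooperPairDMottWalk`, crux `CooperPairDMott`: the loose sectors of the plaquette window

Helper file for the stub `stub_plaquetteGCWindow` (item stmt-HubbardSuperconductivity-1177): lower
bounds `lam_{ab}(U) · ‖v‖² ≤ Re⟨v, H(U) v⟩` on the plaquette sectors `(N↑, N↓) = (a, b)` whose
grand-canonical margin is large (`≥ 0.5`; all sectors except `(2,2)`, `(3,1)`, `(1,3)`, `(3,2)`,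
`(2,3)`), valid for `U ∈ [2, 4]`:

* real-form bounds in the `Fin 4` model by GERSHGORIN, realised as the kernel check `ddCheckP` of
  `…PlaquetteGramCert` with the ZERO Gram factor (plain diagonal dominance of `N(T + U D) − m`):
  `lam = U · d_min − (g_a + g_b)` with `g = 0, 2, 4, 2, 0` the maximal row sums of `K₀, …, K₄` and
  `d_min = max(0, a + b − 4)`; `U`-independent where `d_min = 0` (monotonicity in `U`,
  `formBound_mono`), chords between `U = 2` and `U = 4` otherwise (`form41_lb`, …);
* the sector `(2,1)`: the Gram certificates `form21_lb_0`, `form21_lb_4` of `…PlaquettePairBinding`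
  and the chord on `[2, 4]`;
* transport to the plaquette (`sector_form_lb`) and to the mirrored sectors (`formBound_transpose`):
  `plaq{ab}_lb`.

Sources: E. H. Lieb, PRL 62 (1989) 1201, eq. (4); the checks are a finite computation (`decide`).
All statements are [folklore].
-/

set_option linter.dupNamespace false

noncomputable section

namespace Summit.HubbardSuperconductivity.HubbardSuperconductivity.Theorems.CooperPairDMottWalk

open Literature.MathematicalPhysics.QuantumLattice Literature.MathematicalPhysics.QuantumLattice.TwoSpecies
open Matrix Finset
open scoped ComplexOrder

/-! ### Monotonicity in `U` -/

/-- The double-occupancy form is nonnegative. [folklore] -/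
theorem dblR_nonneg {p q : ℕ} (d : Fin p → Fin q → ℕ) (x : Fin p → Fin q → ℝ) : 0 ≤ dblR d x :=
  Finset.sum_nonneg fun _ _ => Finset.sum_nonneg fun _ _ => mul_nonneg (Nat.cast_nonneg _) (sq_nonneg _)

/-- A form bound at `U = 2` persists for `U ≥ 2` (the interaction is nonnegative). [folklore] -/
theorem formBound_mono {p q : ℕ} {Ka : Fin p → Fin p → ℤ} {Kb : Fin q → Fin q → ℤ}
    {d : Fin p → Fin q → ℕ} {lam : ℝ}
    (h2 : ∀ x : Fin p → Fin q → ℝ, lam * nsqR x ≤ hopR Ka Kb x + 2 * dblR d x)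
    {U : ℝ} (hU2 : 2 ≤ U) (x : Fin p → Fin q → ℝ) : lam * nsqR x ≤ hopR Ka Kb x + U * dblR d x := by
  have := mul_le_mul_of_nonneg_right hU2 (dblR_nonneg d x)
  linarith [h2 x]

/-! ### Gershgorin bounds (zero Gram factor) in the `Fin 4` model -/

/-- Gershgorin lower bound `0` of the sector-`(0,0)` form for `U ≥ 2` (diagonal dominance at
`U = 2`, then monotonicity). [folklore] -/
theorem form00_lb {U : ℝ} (hU2 : 2 ≤ U) (x : Fin 1 → Fin 1 → ℝ) :
    (0 : ℝ) * nsqR x ≤ hopR Kz Kz x + U * dblR (fun i j => (s0 i ∩ s0 j).card) x := by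
  refine formBound_mono (fun y => ?_) hU2 x
  have h := form_lowerBound_of_ddCheckP Kz Kz (fun i j => (s0 i ∩ s0 j).card) 1 2 (0)
    (fun _ _ : Fin 1 × Fin 1 => (0 : ℤ)) (s := 1) one_pos (by decide +kernel) y
  push_cast at h
  linarith

/-- Gershgorin lower bound `-2` of the sector-`(1,0)` form for `U ≥ 2` (diagonal dominance at
`U = 2`, then monotonicity). [folklore] -/
theorem form10_lb {U : ℝ} (hU2 : 2 ≤ U) (x : Fin 4 → Fin 1 → ℝ) :
    (-2 : ℝ) * nsqR x ≤ hopR K1 Kz x + U * dblR (fun i j => (s1 i ∩ s0 j).card) x := by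
  refine formBound_mono (fun y => ?_) hU2 x
  have h := form_lowerBound_of_ddCheckP K1 Kz (fun i j => (s1 i ∩ s0 j).card) 1 2 (-2)
    (fun _ _ : Fin 4 × Fin 1 => (0 : ℤ)) (s := 1) one_pos (by decide +kernel) y
  push_cast at h
  linarith

/-- Gershgorin lower bound `-4` of the sector-`(2,0)` form for `U ≥ 2` (diagonal dominance at
`U = 2`, then monotonicity). [folklore] -/
theorem form20_lb {U : ℝ} (hU2 : 2 ≤ U) (x : Fin 6 → Fin 1 → ℝ) :
    (-4 : ℝ) * nsqR x ≤ hopR K2 Kz x + U * dblR (fun i j => (s2 i ∩ s0 j).card) x := by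
  refine formBound_mono (fun y => ?_) hU2 x
  have h := form_lowerBound_of_ddCheckP K2 Kz (fun i j => (s2 i ∩ s0 j).card) 1 2 (-4)
    (fun _ _ : Fin 6 × Fin 1 => (0 : ℤ)) (s := 1) one_pos (by decide +kernel) y
  push_cast at h
  linarith

/-- Gershgorin lower bound `-2` of the sector-`(3,0)` form for `U ≥ 2` (diagonal dominance at
`U = 2`, then monotonicity). [folklore] -/
theorem form30_lb {U : ℝ} (hU2 : 2 ≤ U) (x : Fin 4 → Fin 1 → ℝ) :
    (-2 : ℝ) * nsqR x ≤ hopR K3 Kz x + U * dblR (fun i j => (s3 i ∩ s0 j).card) x := by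
  refine formBound_mono (fun y => ?_) hU2 x
  have h := form_lowerBound_of_ddCheckP K3 Kz (fun i j => (s3 i ∩ s0 j).card) 1 2 (-2)
    (fun _ _ : Fin 4 × Fin 1 => (0 : ℤ)) (s := 1) one_pos (by decide +kernel) y
  push_cast at h
  linarith

/-- Gershgorin lower bound `0` of the sector-`(4,0)` form for `U ≥ 2` (diagonal dominance at
`U = 2`, then monotonicity). [folklore] -/
theorem form40_lb {U : ℝ} (hU2 : 2 ≤ U) (x : Fin 1 → Fin 1 → ℝ) :
    (0 : ℝ) * nsqR x ≤ hopR Kz Kz x + U * dblR (fun i j => (s4 i ∩ s0 j).card) x := by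
  refine formBound_mono (fun y => ?_) hU2 x
  have h := form_lowerBound_of_ddCheckP Kz Kz (fun i j => (s4 i ∩ s0 j).card) 1 2 (0)
    (fun _ _ : Fin 1 × Fin 1 => (0 : ℤ)) (s := 1) one_pos (by decide +kernel) y
  push_cast at h
  linarith

/-- Gershgorin lower bound `-4` of the sector-`(1,1)` form for `U ≥ 2` (diagonal dominance at
`U = 2`, then monotonicity). [folklore] -/
theorem form11_lb {U : ℝ} (hU2 : 2 ≤ U) (x : Fin 4 → Fin 4 → ℝ) :
    (-4 : ℝ) * nsqR x ≤ hopR K1 K1 x + U * dblR (fun i j => (s1 i ∩ s1 j).card) x := by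
  refine formBound_mono (fun y => ?_) hU2 x
  have h := form_lowerBound_of_ddCheckP K1 K1 (fun i j => (s1 i ∩ s1 j).card) 1 2 (-4)
    (fun _ _ : Fin 4 × Fin 4 => (0 : ℤ)) (s := 1) one_pos (by decide +kernel) y
  push_cast at h
  linarith

/-- Gershgorin lower bound `U - 2` of the sector-`(4,1)` form on `[2, 4]` (diagonal dominance
at `U = 2` and `U = 4`, chord). [folklore] -/
theorem form41_lb {U : ℝ} (hU2 : 2 ≤ U) (hU4 : U ≤ 4) (x : Fin 1 → Fin 4 → ℝ) :
    (U - 2) * nsqR x ≤ hopR Kz K1 x + U * dblR (fun i j => (s4 i ∩ s1 j).card) x := by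
  have h2 : ∀ y : Fin 1 → Fin 4 → ℝ,
      (0 : ℝ) * nsqR y ≤ hopR Kz K1 y + 2 * dblR (fun i j => (s4 i ∩ s1 j).card) y := by
    intro y
    have h := form_lowerBound_of_ddCheckP Kz K1 (fun i j => (s4 i ∩ s1 j).card) 1 2 (0)
      (fun _ _ : Fin 1 × Fin 4 => (0 : ℤ)) (s := 1) one_pos (by decide +kernel) y
    push_cast at h
    linarith
  have h4 : ∀ y : Fin 1 → Fin 4 → ℝ,
      (2 : ℝ) * nsqR y ≤ hopR Kz K1 y + 4 * dblR (fun i j => (s4 i ∩ s1 j).card) y := by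
    intro y
    have h := form_lowerBound_of_ddCheckP Kz K1 (fun i j => (s4 i ∩ s1 j).card) 1 4 (2)
      (fun _ _ : Fin 1 × Fin 4 => (0 : ℤ)) (s := 1) one_pos (by decide +kernel) y
    push_cast at h
    linarith
  have c := formBound_chord24 h2 h4 hU2 hU4 x
  linarith

/-- Gershgorin lower bound `2 * U - 4` of the sector-`(4,2)` form on `[2, 4]` (diagonal dominance
at `U = 2` and `U = 4`, chord). [folklore] -/
theorem form42_lb {U : ℝ} (hU2 : 2 ≤ U) (hU4 : U ≤ 4) (x : Fin 1 → Fin 6 → ℝ) :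
    (2 * U - 4) * nsqR x ≤ hopR Kz K2 x + U * dblR (fun i j => (s4 i ∩ s2 j).card) x := by
  have h2 : ∀ y : Fin 1 → Fin 6 → ℝ,
      (0 : ℝ) * nsqR y ≤ hopR Kz K2 y + 2 * dblR (fun i j => (s4 i ∩ s2 j).card) y := by
    intro y
    have h := form_lowerBound_of_ddCheckP Kz K2 (fun i j => (s4 i ∩ s2 j).card) 1 2 (0)
      (fun _ _ : Fin 1 × Fin 6 => (0 : ℤ)) (s := 1) one_pos (by decide +kernel) y
    push_cast at h
    linarith
  have h4 : ∀ y : Fin 1 → Fin 6 → ℝ,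
      (4 : ℝ) * nsqR y ≤ hopR Kz K2 y + 4 * dblR (fun i j => (s4 i ∩ s2 j).card) y := by
    intro y
    have h := form_lowerBound_of_ddCheckP Kz K2 (fun i j => (s4 i ∩ s2 j).card) 1 4 (4)
      (fun _ _ : Fin 1 × Fin 6 => (0 : ℤ)) (s := 1) one_pos (by decide +kernel) y
    push_cast at h
    linarith
  have c := formBound_chord24 h2 h4 hU2 hU4 x
  linarith

/-- Gershgorin lower bound `2 * U - 4` of the sector-`(3,3)` form on `[2, 4]` (diagonal dominance
at `U = 2` and `U = 4`, chord). [folklore] -/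
theorem form33_lb {U : ℝ} (hU2 : 2 ≤ U) (hU4 : U ≤ 4) (x : Fin 4 → Fin 4 → ℝ) :
    (2 * U - 4) * nsqR x ≤ hopR K3 K3 x + U * dblR (fun i j => (s3 i ∩ s3 j).card) x := by
  have h2 : ∀ y : Fin 4 → Fin 4 → ℝ,
      (0 : ℝ) * nsqR y ≤ hopR K3 K3 y + 2 * dblR (fun i j => (s3 i ∩ s3 j).card) y := by
    intro y
    have h := form_lowerBound_of_ddCheckP K3 K3 (fun i j => (s3 i ∩ s3 j).card) 1 2 (0)
      (fun _ _ : Fin 4 × Fin 4 => (0 : ℤ)) (s := 1) one_pos (by decide +kernel) y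
    push_cast at h
    linarith
  have h4 : ∀ y : Fin 4 → Fin 4 → ℝ,
      (4 : ℝ) * nsqR y ≤ hopR K3 K3 y + 4 * dblR (fun i j => (s3 i ∩ s3 j).card) y := by
    intro y
    have h := form_lowerBound_of_ddCheckP K3 K3 (fun i j => (s3 i ∩ s3 j).card) 1 4 (4)
      (fun _ _ : Fin 4 × Fin 4 => (0 : ℤ)) (s := 1) one_pos (by decide +kernel) y
    push_cast at h
    linarith
  have c := formBound_chord24 h2 h4 hU2 hU4 x
  linarith

/-- Gershgorin lower bound `3 * U - 2` of the sector-`(4,3)` form on `[2, 4]` (diagonal dominance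
at `U = 2` and `U = 4`, chord). [folklore] -/
theorem form43_lb {U : ℝ} (hU2 : 2 ≤ U) (hU4 : U ≤ 4) (x : Fin 1 → Fin 4 → ℝ) :
    (3 * U - 2) * nsqR x ≤ hopR Kz K3 x + U * dblR (fun i j => (s4 i ∩ s3 j).card) x := by
  have h2 : ∀ y : Fin 1 → Fin 4 → ℝ,
      (4 : ℝ) * nsqR y ≤ hopR Kz K3 y + 2 * dblR (fun i j => (s4 i ∩ s3 j).card) y := by
    intro y
    have h := form_lowerBound_of_ddCheckP Kz K3 (fun i j => (s4 i ∩ s3 j).card) 1 2 (4)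
      (fun _ _ : Fin 1 × Fin 4 => (0 : ℤ)) (s := 1) one_pos (by decide +kernel) y
    push_cast at h
    linarith
  have h4 : ∀ y : Fin 1 → Fin 4 → ℝ,
      (10 : ℝ) * nsqR y ≤ hopR Kz K3 y + 4 * dblR (fun i j => (s4 i ∩ s3 j).card) y := by
    intro y
    have h := form_lowerBound_of_ddCheckP Kz K3 (fun i j => (s4 i ∩ s3 j).card) 1 4 (10)
      (fun _ _ : Fin 1 × Fin 4 => (0 : ℤ)) (s := 1) one_pos (by decide +kernel) y
    push_cast at h
    linarith
  have c := formBound_chord24 h2 h4 hU2 hU4 x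
  linarith

/-- Gershgorin lower bound `4 * U` of the sector-`(4,4)` form on `[2, 4]` (diagonal dominance
at `U = 2` and `U = 4`, chord). [folklore] -/
theorem form44_lb {U : ℝ} (hU2 : 2 ≤ U) (hU4 : U ≤ 4) (x : Fin 1 → Fin 1 → ℝ) :
    (4 * U) * nsqR x ≤ hopR Kz Kz x + U * dblR (fun i j => (s4 i ∩ s4 j).card) x := by
  have h2 : ∀ y : Fin 1 → Fin 1 → ℝ,
      (8 : ℝ) * nsqR y ≤ hopR Kz Kz y + 2 * dblR (fun i j => (s4 i ∩ s4 j).card) y := by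
    intro y
    have h := form_lowerBound_of_ddCheckP Kz Kz (fun i j => (s4 i ∩ s4 j).card) 1 2 (8)
      (fun _ _ : Fin 1 × Fin 1 => (0 : ℤ)) (s := 1) one_pos (by decide +kernel) y
    push_cast at h
    linarith
  have h4 : ∀ y : Fin 1 → Fin 1 → ℝ,
      (16 : ℝ) * nsqR y ≤ hopR Kz Kz y + 4 * dblR (fun i j => (s4 i ∩ s4 j).card) y := by
    intro y
    have h := form_lowerBound_of_ddCheckP Kz Kz (fun i j => (s4 i ∩ s4 j).card) 1 4 (16)
      (fun _ _ : Fin 1 × Fin 1 => (0 : ℤ)) (s := 1) one_pos (by decide +kernel) y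
    push_cast at h
    linarith
  have c := formBound_chord24 h2 h4 hU2 hU4 x
  linarith

/-- Chord lower bound of the sector-`(2,1)` form on `[2, 4]` (Gram certificates of
`…PlaquettePairBinding`). [folklore] -/
theorem form21_chord {U : ℝ} (hU2 : 2 ≤ U) (hU4 : U ≤ 4) (x : Fin 6 → Fin 4 → ℝ) :
    ((4 - U) / 2 * (-3211 / 1000) + (U - 2) / 2 * (-2754 / 1000)) * nsqR x ≤
      hopR K2 K1 x + U * dblR d21 x :=
  formBound_chord24 form21_lb_0 form21_lb_4 hU2 hU4 x

/-! ### Plaquette-level bounds on the loose sectors -/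

section Plaquette

variable {U : ℝ}

/-- Sector `(2,1)`. [folklore] -/
theorem plaq21_lb (hU2 : 2 ≤ U) (hU4 : U ≤ 4) (v : Fock (Orb PlaquetteSite)) (hv : IsInSector 2 1 v) :
    ((4 - U) / 2 * (-3211 / 1000) + (U - 2) / 2 * (-2754 / 1000)) * (star v ⬝ᵥ v).re ≤
      (star v ⬝ᵥ (plaquetteHamiltonian U *ᵥ v)).re :=
  sector_form_lb isSubsetEnum_s2 isSubsetEnum_s1 hoppingMatrix_s2 hoppingMatrix_s1 card_s2_inter_s1
    (form21_chord hU2 hU4) v hv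

/-- Sector `(1,2)` (mirror of `(2,1)`). [folklore] -/
theorem plaq12_lb (hU2 : 2 ≤ U) (hU4 : U ≤ 4) (v : Fock (Orb PlaquetteSite)) (hv : IsInSector 1 2 v) :
    ((4 - U) / 2 * (-3211 / 1000) + (U - 2) / 2 * (-2754 / 1000)) * (star v ⬝ᵥ v).re ≤
      (star v ⬝ᵥ (plaquetteHamiltonian U *ᵥ v)).re :=
  sector_form_lb (h := formBound_transpose (form21_chord hU2 hU4)) isSubsetEnum_s1 isSubsetEnum_s2
    hoppingMatrix_s1 hoppingMatrix_s2 (fun j i => by rw [Finset.inter_comm]; exact card_s2_inter_s1 i j) v hv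

/-- Sector `(0,0)` (Gershgorin). [folklore] -/
theorem plaq00_lb (hU2 : 2 ≤ U) (v : Fock (Orb PlaquetteSite)) (hv : IsInSector 0 0 v) :
    (0 : ℝ) * (star v ⬝ᵥ v).re ≤ (star v ⬝ᵥ (plaquetteHamiltonian U *ᵥ v)).re :=
  sector_form_lb isSubsetEnum_s0 isSubsetEnum_s0 hoppingMatrix_s0 hoppingMatrix_s0 (fun _ _ => rfl)
    (form00_lb hU2) v hv

/-- Sector `(1,0)` (Gershgorin). [folklore] -/
theorem plaq10_lb (hU2 : 2 ≤ U) (v : Fock (Orb PlaquetteSite)) (hv : IsInSector 1 0 v) :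
    (-2 : ℝ) * (star v ⬝ᵥ v).re ≤ (star v ⬝ᵥ (plaquetteHamiltonian U *ᵥ v)).re :=
  sector_form_lb isSubsetEnum_s1 isSubsetEnum_s0 hoppingMatrix_s1 hoppingMatrix_s0 (fun _ _ => rfl)
    (form10_lb hU2) v hv

/-- Sector `(0,1)` (mirror of `(1,0)`). [folklore] -/
theorem plaq01_lb (hU2 : 2 ≤ U) (v : Fock (Orb PlaquetteSite)) (hv : IsInSector 0 1 v) :
    (-2 : ℝ) * (star v ⬝ᵥ v).re ≤ (star v ⬝ᵥ (plaquetteHamiltonian U *ᵥ v)).re :=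
  sector_form_lb (h := formBound_transpose (form10_lb hU2)) isSubsetEnum_s0 isSubsetEnum_s1 hoppingMatrix_s0
    hoppingMatrix_s1 (fun _ _ => by rw [Finset.inter_comm]) v hv

/-- Sector `(2,0)` (Gershgorin). [folklore] -/
theorem plaq20_lb (hU2 : 2 ≤ U) (v : Fock (Orb PlaquetteSite)) (hv : IsInSector 2 0 v) :
    (-4 : ℝ) * (star v ⬝ᵥ v).re ≤ (star v ⬝ᵥ (plaquetteHamiltonian U *ᵥ v)).re :=
  sector_form_lb isSubsetEnum_s2 isSubsetEnum_s0 hoppingMatrix_s2 hoppingMatrix_s0 (fun _ _ => rfl)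
    (form20_lb hU2) v hv

/-- Sector `(0,2)` (mirror of `(2,0)`). [folklore] -/
theorem plaq02_lb (hU2 : 2 ≤ U) (v : Fock (Orb PlaquetteSite)) (hv : IsInSector 0 2 v) :
    (-4 : ℝ) * (star v ⬝ᵥ v).re ≤ (star v ⬝ᵥ (plaquetteHamiltonian U *ᵥ v)).re :=
  sector_form_lb (h := formBound_transpose (form20_lb hU2)) isSubsetEnum_s0 isSubsetEnum_s2 hoppingMatrix_s0
    hoppingMatrix_s2 (fun _ _ => by rw [Finset.inter_comm]) v hv

/-- Sector `(3,0)` (Gershgorin). [folklore] -/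
theorem plaq30_lb (hU2 : 2 ≤ U) (v : Fock (Orb PlaquetteSite)) (hv : IsInSector 3 0 v) :
    (-2 : ℝ) * (star v ⬝ᵥ v).re ≤ (star v ⬝ᵥ (plaquetteHamiltonian U *ᵥ v)).re :=
  sector_form_lb isSubsetEnum_s3 isSubsetEnum_s0 hoppingMatrix_s3 hoppingMatrix_s0 (fun _ _ => rfl)
    (form30_lb hU2) v hv

/-- Sector `(0,3)` (mirror of `(3,0)`). [folklore] -/
theorem plaq03_lb (hU2 : 2 ≤ U) (v : Fock (Orb PlaquetteSite)) (hv : IsInSector 0 3 v) :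
    (-2 : ℝ) * (star v ⬝ᵥ v).re ≤ (star v ⬝ᵥ (plaquetteHamiltonian U *ᵥ v)).re :=
  sector_form_lb (h := formBound_transpose (form30_lb hU2)) isSubsetEnum_s0 isSubsetEnum_s3 hoppingMatrix_s0
    hoppingMatrix_s3 (fun _ _ => by rw [Finset.inter_comm]) v hv

/-- Sector `(4,0)` (Gershgorin). [folklore] -/
theorem plaq40_lb (hU2 : 2 ≤ U) (v : Fock (Orb PlaquetteSite)) (hv : IsInSector 4 0 v) :
    (0 : ℝ) * (star v ⬝ᵥ v).re ≤ (star v ⬝ᵥ (plaquetteHamiltonian U *ᵥ v)).re :=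
  sector_form_lb isSubsetEnum_s4 isSubsetEnum_s0 hoppingMatrix_s4 hoppingMatrix_s0 (fun _ _ => rfl)
    (form40_lb hU2) v hv

/-- Sector `(0,4)` (mirror of `(4,0)`). [folklore] -/
theorem plaq04_lb (hU2 : 2 ≤ U) (v : Fock (Orb PlaquetteSite)) (hv : IsInSector 0 4 v) :
    (0 : ℝ) * (star v ⬝ᵥ v).re ≤ (star v ⬝ᵥ (plaquetteHamiltonian U *ᵥ v)).re :=
  sector_form_lb (h := formBound_transpose (form40_lb hU2)) isSubsetEnum_s0 isSubsetEnum_s4 hoppingMatrix_s0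
    hoppingMatrix_s4 (fun _ _ => by rw [Finset.inter_comm]) v hv

/-- Sector `(1,1)` (Gershgorin). [folklore] -/
theorem plaq11_lb (hU2 : 2 ≤ U) (v : Fock (Orb PlaquetteSite)) (hv : IsInSector 1 1 v) :
    (-4 : ℝ) * (star v ⬝ᵥ v).re ≤ (star v ⬝ᵥ (plaquetteHamiltonian U *ᵥ v)).re :=
  sector_form_lb isSubsetEnum_s1 isSubsetEnum_s1 hoppingMatrix_s1 hoppingMatrix_s1 (fun _ _ => rfl)
    (form11_lb hU2) v hv

/-- Sector `(4,1)` (Gershgorin). [folklore] -/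
theorem plaq41_lb (hU2 : 2 ≤ U) (hU4 : U ≤ 4) (v : Fock (Orb PlaquetteSite)) (hv : IsInSector 4 1 v) :
    (U - 2) * (star v ⬝ᵥ v).re ≤ (star v ⬝ᵥ (plaquetteHamiltonian U *ᵥ v)).re :=
  sector_form_lb isSubsetEnum_s4 isSubsetEnum_s1 hoppingMatrix_s4 hoppingMatrix_s1 (fun _ _ => rfl)
    (form41_lb hU2 hU4) v hv

/-- Sector `(1,4)` (mirror of `(4,1)`). [folklore] -/
theorem plaq14_lb (hU2 : 2 ≤ U) (hU4 : U ≤ 4) (v : Fock (Orb PlaquetteSite)) (hv : IsInSector 1 4 v) :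
    (U - 2) * (star v ⬝ᵥ v).re ≤ (star v ⬝ᵥ (plaquetteHamiltonian U *ᵥ v)).re :=
  sector_form_lb (h := formBound_transpose (form41_lb hU2 hU4)) isSubsetEnum_s1 isSubsetEnum_s4 hoppingMatrix_s1
    hoppingMatrix_s4 (fun _ _ => by rw [Finset.inter_comm]) v hv

/-- Sector `(4,2)` (Gershgorin). [folklore] -/
theorem plaq42_lb (hU2 : 2 ≤ U) (hU4 : U ≤ 4) (v : Fock (Orb PlaquetteSite)) (hv : IsInSector 4 2 v) :
    (2 * U - 4) * (star v ⬝ᵥ v).re ≤ (star v ⬝ᵥ (plaquetteHamiltonian U *ᵥ v)).re :=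
  sector_form_lb isSubsetEnum_s4 isSubsetEnum_s2 hoppingMatrix_s4 hoppingMatrix_s2 (fun _ _ => rfl)
    (form42_lb hU2 hU4) v hv

/-- Sector `(2,4)` (mirror of `(4,2)`). [folklore] -/
theorem plaq24_lb (hU2 : 2 ≤ U) (hU4 : U ≤ 4) (v : Fock (Orb PlaquetteSite)) (hv : IsInSector 2 4 v) :
    (2 * U - 4) * (star v ⬝ᵥ v).re ≤ (star v ⬝ᵥ (plaquetteHamiltonian U *ᵥ v)).re :=
  sector_form_lb (h := formBound_transpose (form42_lb hU2 hU4)) isSubsetEnum_s2 isSubsetEnum_s4 hoppingMatrix_s2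
    hoppingMatrix_s4 (fun _ _ => by rw [Finset.inter_comm]) v hv

/-- Sector `(3,3)` (Gershgorin). [folklore] -/
theorem plaq33_lb (hU2 : 2 ≤ U) (hU4 : U ≤ 4) (v : Fock (Orb PlaquetteSite)) (hv : IsInSector 3 3 v) :
    (2 * U - 4) * (star v ⬝ᵥ v).re ≤ (star v ⬝ᵥ (plaquetteHamiltonian U *ᵥ v)).re :=
  sector_form_lb isSubsetEnum_s3 isSubsetEnum_s3 hoppingMatrix_s3 hoppingMatrix_s3 (fun _ _ => rfl)
    (form33_lb hU2 hU4) v hv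

/-- Sector `(4,3)` (Gershgorin). [folklore] -/
theorem plaq43_lb (hU2 : 2 ≤ U) (hU4 : U ≤ 4) (v : Fock (Orb PlaquetteSite)) (hv : IsInSector 4 3 v) :
    (3 * U - 2) * (star v ⬝ᵥ v).re ≤ (star v ⬝ᵥ (plaquetteHamiltonian U *ᵥ v)).re :=
  sector_form_lb isSubsetEnum_s4 isSubsetEnum_s3 hoppingMatrix_s4 hoppingMatrix_s3 (fun _ _ => rfl)
    (form43_lb hU2 hU4) v hv

/-- Sector `(3,4)` (mirror of `(4,3)`). [folklore] -/
theorem plaq34_lb (hU2 : 2 ≤ U) (hU4 : U ≤ 4) (v : Fock (Orb PlaquetteSite)) (hv : IsInSector 3 4 v) :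
    (3 * U - 2) * (star v ⬝ᵥ v).re ≤ (star v ⬝ᵥ (plaquetteHamiltonian U *ᵥ v)).re :=
  sector_form_lb (h := formBound_transpose (form43_lb hU2 hU4)) isSubsetEnum_s3 isSubsetEnum_s4 hoppingMatrix_s3
    hoppingMatrix_s4 (fun _ _ => by rw [Finset.inter_comm]) v hv

/-- Sector `(4,4)` (Gershgorin). [folklore] -/
theorem plaq44_lb (hU2 : 2 ≤ U) (hU4 : U ≤ 4) (v : Fock (Orb PlaquetteSite)) (hv : IsInSector 4 4 v) :
    (4 * U) * (star v ⬝ᵥ v).re ≤ (star v ⬝ᵥ (plaquetteHamiltonian U *ᵥ v)).re :=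
  sector_form_lb isSubsetEnum_s4 isSubsetEnum_s4 hoppingMatrix_s4 hoppingMatrix_s4 (fun _ _ => rfl)
    (form44_lb hU2 hU4) v hv

end Plaquette

/-! ### Registered sub-goal of the crux item (stmt-HubbardSuperconductivity-1177) -/

set_option linter.style.longLine false in
/-- Registered sub-goal `plaquetteGCWindow_sector33` of the crux item: the Gershgorin bound `2U − 4` on the
plaquette sector `(3,3)` (closed restatement of `plaq33_lb`). [folklore] -/
theorem plaquetteGCWindow_sector33 : ∀ {U : ℝ}, 2 ≤ U → U ≤ 4 → ∀ v : Fock (Orb (FermionTorus 2 2)), IsInSector 3 3 v → (2 * U - 4) * (star v ⬝ᵥ v).re ≤ (star v ⬝ᵥ (hubbardTorus 2 2 1 U *ᵥ v)).re :=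
  fun hU2 hU4 v hv => plaq33_lb hU2 hU4 v hv

end Summit.HubbardSuperconductivity.HubbardSuperconductivity.Theorems.CooperPairDMottWalk

end
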